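import Literature.AnabelianGeometry.EtaleTheta.Discharge.Sec3BLambdaInjectiveOfRlfRWeakReflects
import Literature.AnabelianGeometry.EtaleTheta.DivisorMonoidsOfGaloisCoveringConnected
import HarnessLib

/-!
# [EtTh] Def 3.3 (iii) / 3.6 (i) at the CONSTRUCTED data of the connected coverings dominated by `Z^log_∞`:
# pull-back of log-divisors REFLECTS divisibility, and the `Λ = ℝ` binder `hBinj` is a THEOREM there

S. Mochizuki, *The étale theta function and its Frobenioid-theoretic manifestations*, Publ. RIMS **45** (2009)
[MochizukiEtTh2009], Def. 3.3 (iii) PDF p. 73 (`Φ₀(Y) = Div⁺(Z^log_∞)^{Gal(Z^log_∞/Y)}`, `B₀(Y) = Mero(Z^log_∞)^{Gal(Z^log_∞/Y)}`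
for the CONNECTED tempered coverings `Y` dominated by a universal combinatorial covering `Z^log_∞`; pull-back along
`Y' → Y` = inclusion of invariants) [cite: MochizukiEtTh2009, Def 3.3 p.73]; Def. 3.6 (i) p. 76 (`B₀^Λ = B₀`, `B₀^pf`,
`ℝ·Φ₀^birat` for `Λ = ℤ, ℚ, ℝ`) [cite: MochizukiEtTh2009, Def 3.6 p.76]; Def. 3.6 (ii) p. 77 ("the data `(D, Φ, B, B → Φ^gp)`
determines a model Frobenioid `C`") [cite: MochizukiEtTh2009, Def 3.6 p.77]; S. Mochizuki, *The geometry of Frobenioids I*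
(2008), Def. 1.1 (ii) p. 19 / Thm. 5.2 p. 100 ("`B` a group-like monoid on `D`": injective pull-backs).

abc-iut cell, block C / W6, seat abc-iut-w6-d048 (gen 3).  PROOF-ONLY (0 definitions, 0 `Prop` facts, 0 instances).
Sequel of `Sec3BLambdaInjectiveOfRlfRWeakReflects.lean` (same seat: `hBinj` at `ofRlfRWeak dm hpf` from the two
Def. 3.3 (iii)-level clauses `hΦinj`, `hΦrefl`) AT THE DATA constructed by abc-iut-w6-d058
(`DivisorMonoids.ofGaloisActionConnected A hZ`, `DivisorMonoidsOfGaloisCoveringConnected.lean`: the Def. 3.3 (iii) data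
over `D₀` proper = nonempty transitive `G`-sets, `G = Gal(Z^log_∞/X^log)`, `Φ₀(S) = Hom_G(S, Div⁺(Z^log_∞))`,
`B₀(S) = Hom_G(S, Mero(Z^log_∞))`, from a `LogDivisorModel` `Z` with Galois-action record `A`), where `hΦinj` is their
theorem `ofGaloisActionConnected_Φ₀_map_injective`:
* §1 `LogDivisorModel.GaloisAction.phiZeroPull_reflects_dvd` — pull-back of `G`-equivariant effective Cartier
  log-divisor-valued maps along a SURJECTIVE `G`-map `f : S → S'` REFLECTS divisibility: if `φ ∘ f ∣ ψ ∘ f` in `Φ₀(S)`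
  then `φ ∣ ψ` in `Φ₀(S')` (the quotient `φ⁻¹·ψ`, formed pointwise in the group `DIV(Z^log_∞)`, is effective Cartier on
  `im f = S'` and `G`-equivariant because each `g` acts by a group automorphism) — print's "inclusion of invariants
  `Div⁺(Z_∞)^H ⊆ Div⁺(Z_∞)^{H'}` inside one monoid of divisors"; `DivisorMonoids.ofGaloisActionConnected_Φ₀_map_reflects_dvd`
  — so the clause `hΦrefl` is a THEOREM at the connected data (maps of connected `G`-sets are onto).
* §2 **`RealifiedDivisorMonoids.ofRlfRWeak_hBinj_ofGaloisActionConnected`** — the Def. 3.6 (i) binder `hBinj` for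
  `Λ = ℝ` (`B₀^ℝ = ℝ·Φ₀^birat`, weak vocabulary of record) is a THEOREM at these data, NO clause (the parameter `hpf` of
  the weak constructor is inhabited: abc-iut-w6-d057's `isPerfFactorialCof_phiZero`, abc-iut-w5-d179's
  `DivisorMonoids.ofGaloisActionConnected_isPerfFactorialCof`).  The `Λ = ℤ` / `Λ = ℚ` twins are abc-iut-w5-d179's
  `DivisorMonoids.ofGaloisActionConnected_ofRlfZWeak_hBinj` / `…_ofRlfQWeak_hBinj`
  (`BiKummerThm44SubModelConnectedOfGaloisCovering.lean`, via `B₀_map_injective`) — not restated here.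
* §3 consequences, UNCONDITIONAL: for EVERY tempered Frobenioid of monoid type `ℝ` over these data and print's genuine
  base `B^temp(Π)⁰ = ConnectedPart (BTemp Π)` (resp. any base of FSM-type), "`B` is a monoid on `D`" and
  **"`C` IS a Frobenioid"** (Def. 3.6 (ii), last sentence) — no binder at all.
Binder census for `Λ = ℝ` at the constructed connected Def. 3.3 (iii) data: {`hBinj`} ↦ ∅ (with abc-iut-w5-d179's
`Λ = ℤ, ℚ` twins: ∅ for every monoid type).
HONEST FRAMING: refereed pre-IUT material; theorems about a construction over the typed interfaces `LogDivisorModel` /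
`GaloisAction` (one term of Def. 3.3 (iii)'s inductive limit; nothing asserts they arise from an actual curve);
nothing here bears on [IUTchIII] Cor. 3.12; no side taken; typed ≠ proved for anything else.
-/

noncomputable section

namespace Literature.AnabelianGeometry.EtaleTheta

open CategoryTheory Opposite Function Literature.AlgebraicGeometry.Frobenioids
  Literature.AnabelianGeometry.SemiGraphs

universe u uG u' v'

/-! ### §1 Pull-back of log-divisors along a surjective covering map reflects divisibility -/

namespace LogDivisorModel.GaloisAction

variable {Z : LogDivisorModel.{u}} {G : Type u} [Group G] (A : Z.GaloisAction G) {S S' : Action (Type u) G}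

/-- **Pull-back of log-divisors along a SURJECTIVE covering map REFLECTS divisibility**: for `f : S → S'` onto and
`φ, ψ ∈ Φ₀(S') = Hom_G(S', Div⁺(Z^log_∞))`, if `φ ∘ f ∣ ψ ∘ f` in `Φ₀(S)` then `φ ∣ ψ` in `Φ₀(S')` — the pointwise
quotient `φ⁻¹·ψ` (in the group `DIV(Z^log_∞)`) agrees on `im f = S'` with the given effective Cartier quotient and is
`G`-equivariant.  Print: the transition maps of `Φ₀` are inclusions `Div⁺(Z_∞)^H ⊆ Div⁺(Z_∞)^{H'}` of submonoids of one
monoid of log-divisors, in which `b − a` is `H`-invariant when `a`, `b` are. [cite: MochizukiEtTh2009, Def 3.3 p.73] -/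
theorem phiZeroPull_reflects_dvd (f : S ⟶ S') (hf : Function.Surjective f.hom) (φ ψ : A.phiZero S')
    (h : A.phiZeroPull f φ ∣ A.phiZeroPull f ψ) : φ ∣ ψ := by
  obtain ⟨χ, hχ⟩ := h
  have key : ∀ s : S.V, (φ.1 (f.hom s))⁻¹ * ψ.1 (f.hom s) = χ.1 s := by
    intro s
    have hs := congrArg (fun ξ : A.phiZero S => ξ.1 s) hχ
    change ψ.1 (f.hom s) = φ.1 (f.hom s) * χ.1 s at hs
    rw [hs, inv_mul_cancel_left]
  refine ⟨⟨fun t => (φ.1 t)⁻¹ * ψ.1 t, fun t => ?_, fun g t => ?_⟩, ?_⟩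
  · obtain ⟨s, rfl⟩ := hf t
    show (φ.1 (f.hom s))⁻¹ * ψ.1 (f.hom s) ∈ Z.Divplus
    rw [key s]
    exact χ.2.1 s
  · change (φ.1 (S'.ρ g t))⁻¹ * ψ.1 (S'.ρ g t) = A.actDIV g ((φ.1 t)⁻¹ * ψ.1 t)
    rw [φ.2.2, ψ.2.2, map_mul, map_inv]
  · exact Subtype.ext (funext fun t => (mul_inv_cancel_left (φ.1 t) (ψ.1 t)).symm)

/-- Functor form: `Φ₀(f)` reflects divisibility for every covering map `f` with surjective underlying map.
[cite: MochizukiEtTh2009, Def 3.3 p.73] -/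
theorem PhiZero_map_reflects_dvd {S S' : (Action (Type u) G)ᵒᵖ} (f : S ⟶ S') (hf : Function.Surjective f.unop.hom)
    (a b : A.PhiZero.obj S) (h : (A.PhiZero.map f).hom a ∣ (A.PhiZero.map f).hom b) : a ∣ b :=
  A.phiZeroPull_reflects_dvd f.unop hf a b h

end LogDivisorModel.GaloisAction

namespace DivisorMonoids

open LogDivisorModel.GaloisAction

variable {Z : LogDivisorModel.{u}} {G : Type u} [Group G] (A : Z.GaloisAction G) (hZ : Z.CuspLaws)

/-- **The transition maps of `Φ₀` REFLECT divisibility over the connected coverings** dominated by `Z^log_∞` (covering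
maps of connected coverings are onto) — the clause `hΦrefl` of `Sec3BLambdaInjectiveOfRlfR(Weak)Reflects.lean` HOLDS at
these data. [cite: MochizukiEtTh2009, Def 3.3 p.73] -/
theorem ofGaloisActionConnected_Φ₀_map_reflects_dvd {Y Y' : ((isConnectedGSet (G := G)).FullSubcategory)ᵒᵖ}
    (f : Y ⟶ Y') (a b : (ofGaloisActionConnected A hZ).Φ₀.obj Y)
    (h : ((ofGaloisActionConnected A hZ).Φ₀.map f).hom a ∣ ((ofGaloisActionConnected A hZ).Φ₀.map f).hom b) : a ∣ b :=
  A.phiZeroPull_reflects_dvd f.unop.hom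
    (hom_surjective_of_isConnectedGSet Y'.unop.property Y.unop.property f.unop.hom) a b h

end DivisorMonoids

/-! ### §2 The Def. 3.6 (i) binder `hBinj` for `Λ = ℝ` is a THEOREM at the connected data -/

namespace RealifiedDivisorMonoids

open LogDivisorModel.GaloisAction

variable {Z : LogDivisorModel.{u}} {G : Type u} [Group G] (A : Z.GaloisAction G) (hZ : Z.CuspLaws)
  (hpf : ∀ Y : ((isConnectedGSet (G := G)).FullSubcategory)ᵒᵖ,
    IsPerfFactorialCof ((DivisorMonoids.ofGaloisActionConnected A hZ).Φ₀.obj Y))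

/-- **`hBinj` for `Λ = ℝ` at the connected data, NO clause**: every pull-back of `B₀^ℝ = ℝ·Φ₀^birat` of
`ofRlfRWeak (ofGaloisActionConnected A hZ) hpf` is injective (`ofRlfRWeak_hBinj_of_reflects` with both clauses
theorems here). [cite: MochizukiEtTh2009, Def 3.6 p.76] -/
theorem ofRlfRWeak_hBinj_ofGaloisActionConnected :
    ∀ {Y Y' : ((isConnectedGSet (G := G)).FullSubcategory)ᵒᵖ} (g : Y ⟶ Y'),
      Injective ((ofRlfRWeak (DivisorMonoids.ofGaloisActionConnected A hZ) hpf).BΛ.map g).hom :=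
  ofRlfRWeak_hBinj_of_reflects _ hpf (fun g => DivisorMonoids.ofGaloisActionConnected_Φ₀_map_injective A hZ g)
    fun g a b h => DivisorMonoids.ofGaloisActionConnected_Φ₀_map_reflects_dvd A hZ g a b h

/-- `Φ₀^ℝ(g) = Φ₀(g)^rlf` of these data is injective. [cite: MochizukiEtTh2009, Def 3.6 p.76] -/
theorem ofRlfRWeak_ΦR_map_injective_ofGaloisActionConnected
    {Y Y' : ((isConnectedGSet (G := G)).FullSubcategory)ᵒᵖ} (g : Y ⟶ Y') :
    Injective ((ofRlfRWeak (DivisorMonoids.ofGaloisActionConnected A hZ) hpf).ΦR.map g).hom :=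
  ofRlfRWeak_ΦR_map_injective_of_reflects _ hpf (fun g => DivisorMonoids.ofGaloisActionConnected_Φ₀_map_injective A hZ g)
    (fun g a b h => DivisorMonoids.ofGaloisActionConnected_Φ₀_map_reflects_dvd A hZ g a b h) g

end RealifiedDivisorMonoids

/-! ### §3 Monoid type `ℝ`: "`B` is a monoid on `D`" and "`C` IS a Frobenioid" at the connected data — unconditional -/

namespace TemperedFrobenioid

open LogDivisorModel.GaloisAction

variable {Z : LogDivisorModel.{u}} {G : Type u} [Group G] (A : Z.GaloisAction G) (hZ : Z.CuspLaws)
  (hpf : ∀ Y : ((isConnectedGSet (G := G)).FullSubcategory)ᵒᵖ,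
    IsPerfFactorialCof ((DivisorMonoids.ofGaloisActionConnected A hZ).Φ₀.obj Y))

section FSMType

variable {D : Type u'} [Category.{v'} D] {IsRational IsStrictlyRational : (Dᵒᵖ ⥤ CommMonCat.{u}) → Prop}

/-- **Monoid type `ℝ`, base of FSM-type: `C` IS a Frobenioid** — for EVERY tempered Frobenioid over the connected data;
no binder. [cite: MochizukiEtTh2009, Def 3.6 p.77] -/
theorem isFrobenioid_ofRlfRWeak_ofGaloisActionConnected_of_isOfFSMType
    (C₀ : TemperedFrobenioid (RealifiedDivisorMonoids.ofRlfRWeak (DivisorMonoids.ofGaloisActionConnected A hZ) hpf) D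
      (treeCatVocab D IsRational IsStrictlyRational)) (hD : IsOfFSMType D) :
    PreFrobenioid.IsFrobenioid C₀.toElem :=
  C₀.isFrobenioid_of_isOfFSMType (RealifiedDivisorMonoids.ofRlfRWeak_hBinj_ofGaloisActionConnected A hZ hpf) hD

end FSMType

section ConnectedTemperoid

variable {P : Type uG} [Group P] [TopologicalSpace P]
  {IsRational IsStrictlyRational : ((ConnectedPart (BTemp P))ᵒᵖ ⥤ CommMonCat.{u}) → Prop}

/-- **Monoid type `ℝ`, genuine base `B^temp(Π)⁰`: `B = B₀^ℝ|_D ×_{(Φ^{ℝ-log})^gp} Φ^gp` is a monoid on `D`** —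
unconditional at the connected data. [cite: MochizukiEtTh2009, Def 3.6 p.77] -/
theorem isMonoidOn_ratFnFunctor_ofRlfRWeak_ofGaloisActionConnected_connectedPart_bTemp
    (C₀ : TemperedFrobenioid (RealifiedDivisorMonoids.ofRlfRWeak (DivisorMonoids.ofGaloisActionConnected A hZ) hpf)
      (ConnectedPart (BTemp P)) (treeCatVocab (ConnectedPart (BTemp P)) IsRational IsStrictlyRational)) :
    IsMonoidOn C₀.ratFnFunctor :=
  C₀.isMonoidOn_ratFnFunctor_connectedPart_bTemp
    (RealifiedDivisorMonoids.ofRlfRWeak_hBinj_ofGaloisActionConnected A hZ hpf)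

/-- **Monoid type `ℝ`, genuine base `B^temp(Π)⁰`: `C` IS a Frobenioid** (Def. 3.6 (ii), last sentence) — for EVERY
tempered Frobenioid of monoid type `ℝ` over the constructed Def. 3.3 (iii) data of the connected coverings dominated by
`Z^log_∞` and print's genuine base; NO binder. [cite: MochizukiEtTh2009, Def 3.6 p.77] -/
theorem isFrobenioid_ofRlfRWeak_ofGaloisActionConnected_connectedPart_bTemp
    (C₀ : TemperedFrobenioid (RealifiedDivisorMonoids.ofRlfRWeak (DivisorMonoids.ofGaloisActionConnected A hZ) hpf)
      (ConnectedPart (BTemp P)) (treeCatVocab (ConnectedPart (BTemp P)) IsRational IsStrictlyRational)) :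
    PreFrobenioid.IsFrobenioid C₀.toElem :=
  C₀.isFrobenioid_connectedPart_bTemp (RealifiedDivisorMonoids.ofRlfRWeak_hBinj_ofGaloisActionConnected A hZ hpf)

end ConnectedTemperoid

end TemperedFrobenioid

end Literature.AnabelianGeometry.EtaleTheta

end
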